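import Summits.MatrixMultiplication.OmegaCensus.DicyclicN3GeneralCore
import Summits.MatrixMultiplication.OmegaCensus.DicyclicParityTools
import Summits.MatrixMultiplication.OmegaCensus.DicyclicSubgroupRestriction
import Summits.MatrixMultiplication.OmegaCensus.CubeLawParityRank
import HarnessLib

/-!
# Class N3 (`(2,2),(2,2),(u,u+1)`) of the dicyclic-law triples is dead for EVERY quotient `A/⟨c₀⟩` of `2`-rank `≥ 3`

ω-census `pub-omega`, family (b3), seat pub-omega-group gen 13.  Framing: lottery ticket; floor = certified bounds/negative
ranges.  VALUE: kernel theorems about the group-theoretic method (TPP capacity of dihedral-like groups); NOT progress on ω.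

Gen 11 (`DicyclicN3Stable.no_n3_dicyclic_law`) killed the class N3 when `A/⟨c₀⟩` is a `2`-group.  Here only `c₀ ≠ 0`,
`|A| ≡ 2 (mod 3)`, `|A| ≥ 28` and `ψ₁, ψ₂, ψ₃ : A →+ ZMod 2` killing `c₀`, jointly onto `V = 𝔽₂³`, are assumed.

**Theorem (`no_n3_dicyclic_law_general`).** No TPP triple with `|S₀| = |S₁| = |T₀| = |T₁| = 2` attains `3|S||T||U| + 16 = 8|A|`.

*Proof.* Normalise to `|U₁|` odd, vertex `111` exact (`A = (S₀+T₁+U₁) ⊔ (S₁+T₀+U₁) ⊔ (S₁+T₁+U₀)`).  With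
`Ψ = (ψ₁,ψ₂,ψ₃) : A → V` the four trichotomies `Ψdᵢ = 0 ∨ Ψeⱼ = 0 ∨ Ψdᵢ = Ψeⱼ` hold for the differences `dᵢ` of `Sᵢ` and `eⱼ`
of `Tⱼ` (`n3_trichotomies'`, window lemma over the `2`-group `V`).  (C) If all four lie in `{0, γ}`: a non-zero `ω` on `V`
with `ω γ = 0 = ω(Ψδ)`, `δ = (t₁−t₀)−(s₁−s₀)`, makes `φ = ω∘Ψ` constant on every part of `S` and `T` with the right cross
condition, and `no_dicyclic_law_of_two_small_first_second` (restriction to an index-`2` subgroup, gen 13) ends it.  Otherwise,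
by the trichotomies, (A) `Ψd₀ = Ψd₁ = 0`, `Ψe₀ ≠ Ψe₁` or (B) the same with `S, T` swapped.  In (A) take `ω` with
`ω(Ψe₀) ≠ ω(Ψe₁)` and the real character `χ = (−1)^{ω∘Ψ}`: `χ(Sᵢ) = ±2`, `{χ(T₀), χ(T₁)} = {0, ±2}`, `χ(U₁)` odd, `χ(U₀)`
even, and the tiling identity `χ(S₀)χ(T₁)χ(U₁) + χ(S₁)χ(T₀)χ(U₁) + χ(S₁)χ(T₁)χ(U₀) = 0` is impossible by parity; (B) alike.  ∎
-/

namespace Summit.MatrixMultiplication.OmegaCensus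

open Literature.Combinatorics.Additive Finset

section N3

variable {A : Type} [AddCommGroup A] [DecidableEq A] [Fintype A] {G : Type} [Group G] [DecidableEq G]
  {ρ τ : A → G} {c₀ : A}

/-- **Normalised N3 contradiction** (see the module docstring): dicyclic type, `|A| ≡ 2 (mod 3)`, `|A| ≥ 28`,
`A/⟨c₀⟩ ↠ 𝔽₂³`; a TPP triple attaining the dicyclic law with `|S₀| = |S₁| = |T₀| = |T₁| = 2`, `|U₁|` odd, `|U₀|` even and
`8|U₁| + 4|U₀| = |A|`.  Then `False`. [folklore] -/
theorem n3_general_aux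
    (hρρ : ∀ a b, ρ a * ρ b = ρ (a + b)) (hρτ : ∀ a b, ρ a * τ b = τ (b - a))
    (hτρ : ∀ a b, τ a * ρ b = τ (a + b)) (hττ : ∀ a b, τ a * τ b = ρ (c₀ + b - a)) (hc₀ : c₀ ≠ 0)
    (hρ : Function.Injective ρ) (hτ : Function.Injective τ) (hne : ∀ a b, ρ a ≠ τ b)
    (hsurj : ∀ g, (∃ a, ρ a = g) ∨ (∃ a, τ a = g)) (hmod : Fintype.card A % 3 = 2) (hA : 28 ≤ Fintype.card A)
    (ψ₁ ψ₂ ψ₃ : A →+ ZMod 2) (hψc : ψ₁ c₀ = 0 ∧ ψ₂ c₀ = 0 ∧ ψ₃ c₀ = 0)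
    (hψ : ∀ v : ZMod 2 × ZMod 2 × ZMod 2, ∃ y, (ψ₁ y, ψ₂ y, ψ₃ y) = v)
    {S T U : Finset G} (h : TripleProductProperty S T U)
    (hV : 3 * (S.card * T.card * U.card) + 16 = 8 * Fintype.card A)
    (hs₀ : (univ.filter fun a : A => ρ a ∈ S).card = 2) (hs₁ : (univ.filter fun a : A => τ a ∈ S).card = 2)
    (ht₀ : (univ.filter fun a : A => ρ a ∈ T).card = 2) (ht₁ : (univ.filter fun a : A => τ a ∈ T).card = 2)
    (hodd : Odd (univ.filter fun a : A => τ a ∈ U).card) (heven : Even (univ.filter fun a : A => ρ a ∈ U).card)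
    (hex : 8 * (univ.filter fun a : A => τ a ∈ U).card + 4 * (univ.filter fun a : A => ρ a ∈ U).card =
      Fintype.card A) : False := by
  classical
  set S₀ : Finset A := univ.filter fun a => ρ a ∈ S with hS₀
  set S₁ : Finset A := univ.filter fun a => τ a ∈ S with hS₁
  set T₀ : Finset A := univ.filter fun a => ρ a ∈ T with hT₀
  set T₁ : Finset A := univ.filter fun a => τ a ∈ T with hT₁
  set U₀ : Finset A := univ.filter fun a => ρ a ∈ U with hU₀
  set U₁ : Finset A := univ.filter fun a => τ a ∈ U with hU₁
  have h2c := two_c0_eq_zero hρτ hτρ hττ hτ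
  have mS₀ : ∀ a ∈ S₀, cond false (τ a) (ρ a) ∈ S := fun a ha => by simpa [hS₀] using ha
  have mS₁ : ∀ a ∈ S₁, cond true (τ a) (ρ a) ∈ S := fun a ha => by simpa [hS₁] using ha
  have mT₀ : ∀ a ∈ T₀, cond false (τ a) (ρ a) ∈ T := fun a ha => by simpa [hT₀] using ha
  have mT₁ : ∀ a ∈ T₁, cond true (τ a) (ρ a) ∈ T := fun a ha => by simpa [hT₁] using ha
  have mU₀ : ∀ a ∈ U₀, cond false (τ a) (ρ a) ∈ U := fun a ha => by simpa [hU₀] using ha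
  have mU₁ : ∀ a ∈ U₁, cond true (τ a) (ρ a) ∈ U := fun a ha => by simpa [hU₁] using ha
  have cs := card_sumset' hρρ hττ hρ hτ h
  have inj := sum_injOn' hρρ hττ hρ hτ h
  -- the vertex `111`: `A = B011 ⊔ B101 ⊔ B110`
  set B011 := (S₀ ×ˢ T₁ ×ˢ U₁).image fun p : A × A × A => p.1 + p.2.1 + p.2.2 with hB011
  set B101 := (S₁ ×ˢ T₀ ×ˢ U₁).image fun p : A × A × A => p.1 + p.2.1 + p.2.2 with hB101
  set B110 := (S₁ ×ˢ T₁ ×ˢ U₀).image fun p : A × A × A => p.1 + p.2.1 + p.2.2 with hB110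
  have d₁ : Disjoint B101 B011 := (disjoint_sumset₁' hρρ hρτ hτρ hττ hne h) true mS₁ mT₀ mU₁ mS₀ mT₁
  have d₂ : Disjoint B110 B101 := (disjoint_sumset₂' hρρ hρτ hτρ hττ hne h) true mS₁ mT₁ mU₀ mS₁ mT₀ mU₁
  have d₃ : Disjoint B011 B110 := (disjoint_sumset₃' hρρ hρτ hτρ hττ hne h) true mS₀ mT₁ mU₁ mS₁ mU₀
  have c011 : B011.card = 2 * 2 * U₁.card := by rw [hB011, cs false true true mS₀ mT₁ mU₁, hs₀, ht₁]
  have c101 : B101.card = 2 * 2 * U₁.card := by rw [hB101, cs true false true mS₁ mT₀ mU₁, hs₁, ht₀]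
  have c110 : B110.card = 2 * 2 * U₀.card := by rw [hB110, cs true true false mS₁ mT₁ mU₀, hs₁, ht₁]
  have hunion : B011 ∪ B101 ∪ B110 = univ := by
    apply eq_univ_of_card
    rw [card_union_of_disjoint (disjoint_union_left.2 ⟨d₃, d₂.symm⟩), card_union_of_disjoint d₁.symm, c011, c101,
      c110, ← hex]
    ring
  -- the elements of the two-element parts
  obtain ⟨s₀, s₀', hss₀, hS₀eq⟩ := card_eq_two.1 hs₀
  obtain ⟨s₁, s₁', hss₁, hS₁eq⟩ := card_eq_two.1 hs₁
  obtain ⟨t₀, t₀', htt₀, hT₀eq⟩ := card_eq_two.1 ht₀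
  obtain ⟨t₁, t₁', htt₁, hT₁eq⟩ := card_eq_two.1 ht₁
  -- the map `Ψ : A → V = 𝔽₂³`
  let Ψ : A →+ ZMod 2 × ZMod 2 × ZMod 2 := ψ₁.prod (ψ₂.prod ψ₃)
  have hΨ : ∀ a, Ψ a = (ψ₁ a, ψ₂ a, ψ₃ a) := fun a => rfl
  have hΨc : Ψ c₀ = 0 := by rw [hΨ, hψc.1, hψc.2.1, hψc.2.2]; rfl
  have hΨsurj : Function.Surjective Ψ := fun v => by
    obtain ⟨a, ha⟩ := hψ v
    exact ⟨a, by rw [hΨ]; exact ha⟩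
  -- the four trichotomies over `V`
  obtain ⟨T00, T01, T10, T11⟩ := n3_trichotomies' hρρ hρτ hτρ hττ hc₀ hρ hτ hne Ψ hΨc f2cube_two_nsmul h hss₀ hss₁
    htt₀ htt₁ hS₀eq hS₁eq hT₀eq hT₁eq hodd hex
  -- the `𝔽₂³` trace and the characters `ω_w`
  let σ : (ZMod 2 × ZMod 2 × ZMod 2) →+ ZMod 2 :=
    (AddMonoidHom.fst (ZMod 2) (ZMod 2 × ZMod 2)) + (AddMonoidHom.fst (ZMod 2) (ZMod 2)).comp
      (AddMonoidHom.snd (ZMod 2) (ZMod 2 × ZMod 2)) + (AddMonoidHom.snd (ZMod 2) (ZMod 2)).comp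
      (AddMonoidHom.snd (ZMod 2) (ZMod 2 × ZMod 2))
  have hσ : ∀ w v : ZMod 2 × ZMod 2 × ZMod 2, (σ.comp (AddMonoidHom.mulLeft w)) v = (w * v).1 + (w * v).2.1 + (w * v).2.2 :=
    fun w v => rfl
  -- real-character identity on the tiling
  have key : ∀ ω : (ZMod 2 × ZMod 2 × ZMod 2) →+ ZMod 2, (∃ a, ω (Ψ a) ≠ 0) →
      ((if ω (Ψ s₀) = 0 then (1 : ℤ) else -1) + (if ω (Ψ s₀') = 0 then (1 : ℤ) else -1)) *
          ((if ω (Ψ t₁) = 0 then (1 : ℤ) else -1) + (if ω (Ψ t₁') = 0 then (1 : ℤ) else -1)) *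
          (∑ a ∈ U₁, (if ω (Ψ a) = 0 then (1 : ℤ) else -1)) +
        ((if ω (Ψ s₁) = 0 then (1 : ℤ) else -1) + (if ω (Ψ s₁') = 0 then (1 : ℤ) else -1)) *
          ((if ω (Ψ t₀) = 0 then (1 : ℤ) else -1) + (if ω (Ψ t₀') = 0 then (1 : ℤ) else -1)) *
          (∑ a ∈ U₁, (if ω (Ψ a) = 0 then (1 : ℤ) else -1)) +
        ((if ω (Ψ s₁) = 0 then (1 : ℤ) else -1) + (if ω (Ψ s₁') = 0 then (1 : ℤ) else -1)) *
          ((if ω (Ψ t₁) = 0 then (1 : ℤ) else -1) + (if ω (Ψ t₁') = 0 then (1 : ℤ) else -1)) *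
          (∑ a ∈ U₀, (if ω (Ψ a) = 0 then (1 : ℤ) else -1)) = 0 := by
    intro ω hω
    set φ : A →+ ZMod 2 := ω.comp Ψ with hφ
    have hφa : ∀ a, φ a = ω (Ψ a) := fun a => rfl
    have hmul := homSgn_mul φ
    have hsum := homSgn_sum φ (by obtain ⟨a, ha⟩ := hω; exact ⟨a, by rw [hφa]; exact ha⟩)
    have e011 := realChar_sumset (χ := fun a => if φ a = 0 then (1 : ℤ) else -1) hmul (inj false true true mS₀ mT₁ mU₁)
    have e101 := realChar_sumset (χ := fun a => if φ a = 0 then (1 : ℤ) else -1) hmul (inj true false true mS₁ mT₀ mU₁)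
    have e110 := realChar_sumset (χ := fun a => if φ a = 0 then (1 : ℤ) else -1) hmul (inj true true false mS₁ mT₁ mU₀)
    have htot : (∑ a, (fun a => if φ a = 0 then (1 : ℤ) else -1) a) =
        (∑ x ∈ B011, (fun a => if φ a = 0 then (1 : ℤ) else -1) x) +
        (∑ x ∈ B101, (fun a => if φ a = 0 then (1 : ℤ) else -1) x) +
        (∑ x ∈ B110, (fun a => if φ a = 0 then (1 : ℤ) else -1) x) := by
      rw [← hunion, sum_union (disjoint_union_left.2 ⟨d₃, d₂.symm⟩), sum_union d₁.symm]
    rw [hsum, hB011, hB101, hB110, e011, e101, e110, hS₀eq, hS₁eq, hT₀eq, hT₁eq, sum_pair hss₀, sum_pair hss₁,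
      sum_pair htt₀, sum_pair htt₁] at htot
    simp only [hφa] at htot
    linarith
  -- pair sums and parities
  have hzmod : ∀ z : ZMod 2, z = 0 ∨ z = 1 := by decide
  have pair2 : ∀ (ω : (ZMod 2 × ZMod 2 × ZMod 2) →+ ZMod 2) (x x' : A), ω (Ψ (x' - x)) = 0 →
      (if ω (Ψ x) = 0 then (1 : ℤ) else -1) + (if ω (Ψ x') = 0 then (1 : ℤ) else -1) =
        2 * (if ω (Ψ x) = 0 then (1 : ℤ) else -1) := by
    intro ω x x' h0
    have : ω (Ψ x') = ω (Ψ x) := by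
      have h' := h0; rw [map_sub, map_sub, sub_eq_zero] at h'; exact h'
    rw [this]; ring
  have pair0 : ∀ (ω : (ZMod 2 × ZMod 2 × ZMod 2) →+ ZMod 2) (x x' : A), ω (Ψ (x' - x)) ≠ 0 →
      (if ω (Ψ x) = 0 then (1 : ℤ) else -1) + (if ω (Ψ x') = 0 then (1 : ℤ) else -1) = 0 := by
    intro ω x x' h0
    rw [map_sub, map_sub] at h0
    rcases hzmod (ω (Ψ x)) with hx | hx <;> rcases hzmod (ω (Ψ x')) with hx' | hx'
    · exact absurd (by rw [hx, hx', sub_self]) h0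
    · rw [hx, hx']; decide
    · rw [hx, hx']; decide
    · exact absurd (by rw [hx, hx', sub_self]) h0
  have sgn_cases : ∀ z : ZMod 2, (if z = 0 then (1 : ℤ) else -1) = 1 ∨ (if z = 0 then (1 : ℤ) else -1) = -1 := by
    intro z; split_ifs; exacts [Or.inl rfl, Or.inr rfl]
  have parU₁ : ∀ ω : (ZMod 2 × ZMod 2 × ZMod 2) →+ ZMod 2,
      ∃ m : ℤ, (∑ a ∈ U₁, (if ω (Ψ a) = 0 then (1 : ℤ) else -1)) = 2 * m + 1 := by
    intro ω
    have := sgnSum_eq_card_sub (ω.comp Ψ) U₁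
    simp only [AddMonoidHom.coe_comp, Function.comp_apply] at this
    obtain ⟨k, hk⟩ := hodd
    refine ⟨(k : ℤ) - ((U₁.filter fun a => ω (Ψ a) ≠ 0).card : ℤ), ?_⟩
    rw [this, hk]; push_cast; ring
  have parU₀ : ∀ ω : (ZMod 2 × ZMod 2 × ZMod 2) →+ ZMod 2,
      ∃ m : ℤ, (∑ a ∈ U₀, (if ω (Ψ a) = 0 then (1 : ℤ) else -1)) = 2 * m := by
    intro ω
    have := sgnSum_eq_card_sub (ω.comp Ψ) U₀
    simp only [AddMonoidHom.coe_comp, Function.comp_apply] at this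
    obtain ⟨k, hk⟩ := heven
    refine ⟨(k : ℤ) - ((U₀.filter fun a => ω (Ψ a) ≠ 0).card : ℤ), ?_⟩
    rw [this, hk]; push_cast; ring
  -- (C) all four differences in `{0, γ}`: the subgroup restriction
  by_cases hγ : ∃ γ : ZMod 2 × ZMod 2 × ZMod 2, (Ψ (s₀' - s₀) = 0 ∨ Ψ (s₀' - s₀) = γ) ∧
      (Ψ (s₁' - s₁) = 0 ∨ Ψ (s₁' - s₁) = γ) ∧ (Ψ (t₀' - t₀) = 0 ∨ Ψ (t₀' - t₀) = γ) ∧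
      (Ψ (t₁' - t₁) = 0 ∨ Ψ (t₁' - t₁) = γ)
  · obtain ⟨γ, hd₀, hd₁, he₀, he₁⟩ := hγ
    set δ : A := t₁ - t₀ - (s₁ - s₀) with hδ
    obtain ⟨w, hw0, hwγ, hwδ⟩ := f2cube_exists_perp₂ γ (Ψ δ)
    let ω : (ZMod 2 × ZMod 2 × ZMod 2) →+ ZMod 2 := σ.comp (AddMonoidHom.mulLeft w)
    have hωγ : ω γ = 0 := by rw [hσ]; exact hwγ
    have hωδ : ω (Ψ δ) = 0 := by rw [hσ]; exact hwδ
    have kill : ∀ z, (z = 0 ∨ z = γ) → ω z = 0 := by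
      rintro z (rfl | rfl)
      · exact map_zero ω
      · exact hωγ
    set φ : A →+ ZMod 2 := ω.comp Ψ with hφdef
    have hφa : ∀ a, φ a = ω (Ψ a) := fun a => rfl
    have hφc : φ c₀ = 0 := by rw [hφa, hΨc, map_zero]
    have hφ : ∃ a, φ a ≠ 0 := by
      obtain ⟨z, hz⟩ := f2cube_exists_pair_one' w hw0
      obtain ⟨a, ha⟩ := hΨsurj z
      exact ⟨a, by rw [hφa, ha, hσ]; exact hz⟩
    have hφd₀ : φ (s₀' - s₀) = 0 := kill _ hd₀
    have hφd₁ : φ (s₁' - s₁) = 0 := kill _ hd₁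
    have hφe₀ : φ (t₀' - t₀) = 0 := kill _ he₀
    have hφe₁ : φ (t₁' - t₁) = 0 := kill _ he₁
    have hφδ : φ δ = 0 := hωδ
    refine no_dicyclic_law_of_two_small_first_second hρρ hρτ hτρ hττ hc₀ hρ hτ hne hsurj hmod hA ψ₁ ψ₂ ψ₃ hψc hψ h hV
      φ hφc hφ (s₁ - s₀) (φ s₀) (φ t₀) ?_ ?_ ?_ ?_
    · intro a ha
      have : a ∈ S₀ := mem_filter.2 ⟨mem_univ _, ha⟩
      rw [hS₀eq, mem_insert, mem_singleton] at this
      rcases this with ha' | ha'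
      · rw [ha']
      · have e : φ s₀' = φ s₀ + φ (s₀' - s₀) := by rw [map_sub]; ring
        rw [ha', e, hφd₀, add_zero]
    · intro a ha
      have : a ∈ S₁ := mem_filter.2 ⟨mem_univ _, ha⟩
      rw [hS₁eq, mem_insert, mem_singleton] at this
      rcases this with ha' | ha'
      · rw [ha', map_sub]; ring
      · have e : φ s₁' = φ s₀ + φ (s₁ - s₀) + φ (s₁' - s₁) := by rw [map_sub, map_sub]; ring
        rw [ha', e, hφd₁, add_zero]
    · intro a ha
      have : a ∈ T₀ := mem_filter.2 ⟨mem_univ _, ha⟩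
      rw [hT₀eq, mem_insert, mem_singleton] at this
      rcases this with ha' | ha'
      · rw [ha']
      · have e : φ t₀' = φ t₀ + φ (t₀' - t₀) := by rw [map_sub]; ring
        rw [ha', e, hφe₀, add_zero]
    · intro a ha
      have : a ∈ T₁ := mem_filter.2 ⟨mem_univ _, ha⟩
      rw [hT₁eq, mem_insert, mem_singleton] at this
      have e1 : φ t₁ = φ t₀ + φ (s₁ - s₀) + φ δ := by simp only [hδ, map_sub]; ring
      rcases this with ha' | ha'
      · rw [ha', e1, hφδ, add_zero]
      · have e : φ t₁' = φ t₁ + φ (t₁' - t₁) := by rw [map_sub]; ring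
        rw [ha', e, hφe₁, add_zero, e1, hφδ, add_zero]
  -- otherwise (A) or (B)
  have hAB : (Ψ (s₀' - s₀) = 0 ∧ Ψ (s₁' - s₁) = 0 ∧ Ψ (t₀' - t₀) ≠ Ψ (t₁' - t₁)) ∨
      (Ψ (t₀' - t₀) = 0 ∧ Ψ (t₁' - t₁) = 0 ∧ Ψ (s₀' - s₀) ≠ Ψ (s₁' - s₁)) := by
    by_cases he0 : Ψ (t₀' - t₀) = 0 <;> by_cases he1 : Ψ (t₁' - t₁) = 0
    · right
      refine ⟨he0, he1, fun hdd => hγ ⟨Ψ (s₀' - s₀), Or.inr rfl, Or.inr hdd.symm, Or.inl he0, Or.inl he1⟩⟩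
    · exfalso
      refine hγ ⟨Ψ (t₁' - t₁), ?_, ?_, Or.inl he0, Or.inr rfl⟩
      · rcases T01 with h' | h' | h'
        exacts [Or.inl h', absurd h' he1, Or.inr h']
      · rcases T11 with h' | h' | h'
        exacts [Or.inl h', absurd h' he1, Or.inr h']
    · exfalso
      refine hγ ⟨Ψ (t₀' - t₀), ?_, ?_, Or.inr rfl, Or.inl he1⟩
      · rcases T00 with h' | h' | h'
        exacts [Or.inl h', absurd h' he0, Or.inr h']
      · rcases T10 with h' | h' | h'
        exacts [Or.inl h', absurd h' he0, Or.inr h']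
    · by_cases hd0 : Ψ (s₀' - s₀) = 0
      · by_cases hd1 : Ψ (s₁' - s₁) = 0
        · by_cases hee : Ψ (t₀' - t₀) = Ψ (t₁' - t₁)
          · exfalso; exact hγ ⟨Ψ (t₀' - t₀), Or.inl hd0, Or.inl hd1, Or.inr rfl, Or.inr hee.symm⟩
          · exact Or.inl ⟨hd0, hd1, hee⟩
        · exfalso
          have h1 : Ψ (s₁' - s₁) = Ψ (t₀' - t₀) := by
            rcases T10 with h' | h' | h'
            exacts [absurd h' hd1, absurd h' he0, h']
          have h2 : Ψ (s₁' - s₁) = Ψ (t₁' - t₁) := by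
            rcases T11 with h' | h' | h'
            exacts [absurd h' hd1, absurd h' he1, h']
          exact hγ ⟨Ψ (s₁' - s₁), Or.inl hd0, Or.inr rfl, Or.inr h1.symm, Or.inr h2.symm⟩
      · exfalso
        have h1 : Ψ (s₀' - s₀) = Ψ (t₀' - t₀) := by
          rcases T00 with h' | h' | h'
          exacts [absurd h' hd0, absurd h' he0, h']
        have h2 : Ψ (s₀' - s₀) = Ψ (t₁' - t₁) := by
          rcases T01 with h' | h' | h'
          exacts [absurd h' hd0, absurd h' he1, h']
        have h3 : Ψ (s₁' - s₁) = 0 ∨ Ψ (s₁' - s₁) = Ψ (s₀' - s₀) := by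
          rcases T10 with h' | h' | h'
          exacts [Or.inl h', absurd h' he0, Or.inr (h'.trans h1.symm)]
        exact hγ ⟨Ψ (s₀' - s₀), Or.inr rfl, h3, Or.inr h1.symm, Or.inr h2.symm⟩
  rcases hAB with ⟨hd0, hd1, hee⟩ | ⟨he0, he1, hdd⟩
  · -- (A): separate `Ψe₀` from `Ψe₁`
    obtain ⟨w, hw⟩ := f2cube_exists_pair_one' (Ψ (t₀' - t₀) - Ψ (t₁' - t₁)) (sub_ne_zero.2 hee)
    let ω : (ZMod 2 × ZMod 2 × ZMod 2) →+ ZMod 2 := σ.comp (AddMonoidHom.mulLeft w)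
    have hωsep : ω (Ψ (t₀' - t₀)) ≠ ω (Ψ (t₁' - t₁)) := by
      intro heq
      apply hw
      rw [mul_comm, ← hσ, map_sub, heq, sub_self]
    have hωd0 : ω (Ψ (s₀' - s₀)) = 0 := by rw [hd0, map_zero]
    have hωd1 : ω (Ψ (s₁' - s₁)) = 0 := by rw [hd1, map_zero]
    obtain ⟨m₁, hm₁⟩ := parU₁ ω
    obtain ⟨m₀, hm₀⟩ := parU₀ ω
    by_cases he1z : ω (Ψ (t₁' - t₁)) = 0
    · have he0z : ω (Ψ (t₀' - t₀)) ≠ 0 := fun h0 => hωsep (h0.trans he1z.symm)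
      have hω : ∃ a, ω (Ψ a) ≠ 0 := ⟨_, he0z⟩
      have E := key ω hω
      rw [pair2 ω s₀ s₀' hωd0, pair2 ω s₁ s₁' hωd1, pair0 ω t₀ t₀' he0z, pair2 ω t₁ t₁' he1z, hm₁, hm₀] at E
      rcases sgn_cases (ω (Ψ s₀)) with a | a <;> rcases sgn_cases (ω (Ψ s₁)) with b | b <;>
        rcases sgn_cases (ω (Ψ t₁)) with c | c <;> rw [a, b, c] at E <;> omega
    · have he0z : ω (Ψ (t₀' - t₀)) = 0 := by
        rcases hzmod (ω (Ψ (t₀' - t₀))) with h0 | h0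
        · exact h0
        · rcases hzmod (ω (Ψ (t₁' - t₁))) with h1 | h1
          · exact absurd h1 he1z
          · exact absurd (h0.trans h1.symm) hωsep
      have hω : ∃ a, ω (Ψ a) ≠ 0 := ⟨_, he1z⟩
      have E := key ω hω
      rw [pair2 ω s₀ s₀' hωd0, pair2 ω s₁ s₁' hωd1, pair2 ω t₀ t₀' he0z, pair0 ω t₁ t₁' he1z, hm₁, hm₀] at E
      rcases sgn_cases (ω (Ψ s₀)) with a | a <;> rcases sgn_cases (ω (Ψ s₁)) with b | b <;>
        rcases sgn_cases (ω (Ψ t₀)) with c | c <;> rw [a, b, c] at E <;> omega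
  · -- (B): separate `Ψd₀` from `Ψd₁`
    obtain ⟨w, hw⟩ := f2cube_exists_pair_one' (Ψ (s₀' - s₀) - Ψ (s₁' - s₁)) (sub_ne_zero.2 hdd)
    let ω : (ZMod 2 × ZMod 2 × ZMod 2) →+ ZMod 2 := σ.comp (AddMonoidHom.mulLeft w)
    have hωsep : ω (Ψ (s₀' - s₀)) ≠ ω (Ψ (s₁' - s₁)) := by
      intro heq
      apply hw
      rw [mul_comm, ← hσ, map_sub, heq, sub_self]
    have hωe0 : ω (Ψ (t₀' - t₀)) = 0 := by rw [he0, map_zero]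
    have hωe1 : ω (Ψ (t₁' - t₁)) = 0 := by rw [he1, map_zero]
    obtain ⟨m₁, hm₁⟩ := parU₁ ω
    obtain ⟨m₀, hm₀⟩ := parU₀ ω
    by_cases hd1z : ω (Ψ (s₁' - s₁)) = 0
    · have hd0z : ω (Ψ (s₀' - s₀)) ≠ 0 := fun h0 => hωsep (h0.trans hd1z.symm)
      have hω : ∃ a, ω (Ψ a) ≠ 0 := ⟨_, hd0z⟩
      have E := key ω hω
      rw [pair0 ω s₀ s₀' hd0z, pair2 ω s₁ s₁' hd1z, pair2 ω t₀ t₀' hωe0, pair2 ω t₁ t₁' hωe1, hm₁, hm₀] at E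
      rcases sgn_cases (ω (Ψ s₁)) with a | a <;> rcases sgn_cases (ω (Ψ t₀)) with b | b <;>
        rcases sgn_cases (ω (Ψ t₁)) with c | c <;> rw [a, b, c] at E <;> omega
    · have hd0z : ω (Ψ (s₀' - s₀)) = 0 := by
        rcases hzmod (ω (Ψ (s₀' - s₀))) with h0 | h0
        · exact h0
        · rcases hzmod (ω (Ψ (s₁' - s₁))) with h1 | h1
          · exact absurd h1 hd1z
          · exact absurd (h0.trans h1.symm) hωsep
      have hω : ∃ a, ω (Ψ a) ≠ 0 := ⟨_, hd1z⟩
      have E := key ω hω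
      rw [pair2 ω s₀ s₀' hd0z, pair0 ω s₁ s₁' hd1z, pair2 ω t₀ t₀' hωe0, pair2 ω t₁ t₁' hωe1, hm₁, hm₀] at E
      rcases sgn_cases (ω (Ψ s₀)) with a | a <;> rcases sgn_cases (ω (Ψ t₁)) with c | c <;>
        rw [a, c] at E <;> omega

/-- **No N3-class dicyclic-law triple for ANY `A/⟨c₀⟩` of `2`-rank `≥ 3`.**  Dicyclic type (`c₀ ≠ 0`), `|A| ≡ 2 (mod 3)`,
`|A| ≥ 28`, three homomorphisms `A →+ ZMod 2` killing `c₀` jointly onto `𝔽₂³` (no `2`-group hypothesis).  Then no TPP triple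
with `|S₀| = |S₁| = |T₀| = |T₁| = 2` attains `3|S||T||U| + 16 = 8|A|`.  (Reduction as in gen 11's `no_n3_dicyclic_law`:
`{|U₀|, |U₁|} = {u, u+1}` with `u` even, and a `τ0`-translation of `U` when `|U₀|` is the odd part.) [folklore] -/
theorem no_n3_dicyclic_law_general
    (hρρ : ∀ a b, ρ a * ρ b = ρ (a + b)) (hρτ : ∀ a b, ρ a * τ b = τ (b - a))
    (hτρ : ∀ a b, τ a * ρ b = τ (a + b)) (hττ : ∀ a b, τ a * τ b = ρ (c₀ + b - a)) (hc₀ : c₀ ≠ 0)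
    (hρ : Function.Injective ρ) (hτ : Function.Injective τ) (hne : ∀ a b, ρ a ≠ τ b)
    (hsurj : ∀ g, (∃ a, ρ a = g) ∨ (∃ a, τ a = g)) (hmod : Fintype.card A % 3 = 2) (hA : 28 ≤ Fintype.card A)
    (ψ₁ ψ₂ ψ₃ : A →+ ZMod 2) (hψc : ψ₁ c₀ = 0 ∧ ψ₂ c₀ = 0 ∧ ψ₃ c₀ = 0)
    (hψ : ∀ v : ZMod 2 × ZMod 2 × ZMod 2, ∃ x, (ψ₁ x, ψ₂ x, ψ₃ x) = v)
    {S T U : Finset G} (h : TripleProductProperty S T U)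
    (hs₀ : (univ.filter fun a : A => ρ a ∈ S).card = 2) (hs₁ : (univ.filter fun a : A => τ a ∈ S).card = 2)
    (ht₀ : (univ.filter fun a : A => ρ a ∈ T).card = 2) (ht₁ : (univ.filter fun a : A => τ a ∈ T).card = 2) :
    3 * (S.card * T.card * U.card) + 16 ≠ 8 * Fintype.card A := by
  intro hV
  have cS : S.card = 4 := by rw [card_eq_parts' hρ hτ hne hsurj S, hs₀, hs₁]
  have cT : T.card = 4 := by rw [card_eq_parts' hρ hτ hne hsurj T, ht₀, ht₁]
  have cU := card_eq_parts' hρ hτ hne hsurj U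
  have h8 : 8 ∣ Fintype.card A := eight_dvd_card_of_onto ψ₁ ψ₂ ψ₃ hψ
  obtain ⟨-, -, h000, h111⟩ := parts_counting' hρρ hρτ hτρ hττ hρ hτ hne h
  rw [hs₀, hs₁, ht₀, ht₁] at h000 h111
  have hV' := hV
  rw [cS, cT, cU] at hV'
  set u₀ := (univ.filter fun a : A => ρ a ∈ U).card with hu₀
  set u₁ := (univ.filter fun a : A => τ a ∈ U).card with hu₁
  obtain ⟨k, hk⟩ := h8
  by_cases hcase : u₁ = u₀ + 1
  · have hodd : Odd u₁ := ⟨u₀ / 2, by omega⟩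
    have heven : Even u₀ := ⟨u₀ / 2, by omega⟩
    exact n3_general_aux hρρ hρτ hτρ hττ hc₀ hρ hτ hne hsurj hmod hA ψ₁ ψ₂ ψ₃ hψc hψ h hV hs₀ hs₁ ht₀ ht₁ hodd heven
      (by omega)
  · have hcase' : u₀ = u₁ + 1 := by omega
    have er : (Equiv.mulRight (1 : G)).toEmbedding = Function.Embedding.refl G := by ext x; simp
    have h' : TripleProductProperty S T (U.map (Equiv.mulRight (τ 0)).toEmbedding) := by
      have := h.map_mulRight 1 1 (τ 0); simpa only [er, Finset.map_refl] using this
    have cU'₀ := card_rho_part_mulRight_tau hρρ hρτ hττ (A := A) U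
    have cU'₁ := card_tau_part_mulRight_tau hρρ hττ (A := A) U
    have hodd : Odd (univ.filter fun a : A => τ a ∈ U.map (Equiv.mulRight (τ 0)).toEmbedding).card := by
      rw [cU'₁]; exact ⟨u₁ / 2, by omega⟩
    have heven : Even (univ.filter fun a : A => ρ a ∈ U.map (Equiv.mulRight (τ 0)).toEmbedding).card := by
      rw [cU'₀]; exact ⟨u₁ / 2, by omega⟩
    have hVmap : 3 * (S.card * T.card * (U.map (Equiv.mulRight (τ 0)).toEmbedding).card) + 16 =
        8 * Fintype.card A := by rw [card_map]; exact hV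
    exact n3_general_aux hρρ hρτ hτρ hττ hc₀ hρ hτ hne hsurj hmod hA ψ₁ ψ₂ ψ₃ hψc hψ h' hVmap hs₀ hs₁ ht₀ ht₁ hodd heven
      (by rw [cU'₀, cU'₁]; omega)

end N3

end Summit.MatrixMultiplication.OmegaCensus
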